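import Literature.MathematicalPhysics.QuantumFieldTheory.Balaban1983to89.B9Eq342SupNormBootstrap

/-!
# `Balaban1983to89.B9Eq342SupNormBootstrapWeightedChain` — T. Bałaban, *Propagators for lattice gauge theories in a background field*, Commun. Math. Phys. **99**
# (1985) 389–434 [Balaban1985BackgroundPropagators] Thm 3.1 (3.42) p. 397 (the factor `e^{−δ₀d(y,y′)}`), (3.39) p. 397, (3.24) p. 394: **THE WEIGHTED BOOTSTRAP
# WITH `k` DOMINATIONS — `‖u(x)‖ ≤ s·W(x)·Σ_{l<k}(m∕λ)^l + m^k·φ_k(x)` for ANY supersolution weight `λW ≤ (L₀+m)W` and ANY `k`-chain `φ₀ = ‖u‖`,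
# `(L₀+m)φ_{j+1} = φ_j`** — the abstract half of storey (D) of the NE9 owner's SUP-NORM PROGRAMME (plan v10 §5 (D-A) «the k-fold domination chain … read in the
# weighted sup norm») at general `k`, so that the decayed free letter (D-FS) `B5Eq129FreeResolventDecayedLetter.chain_apply_le_weighted` (which is LEVEL-FREE
# only for `k ≥ d`) can close it; the `k = 1` case with the second resolvent displayed is the owner's `B9Eq342SupNormBootstrapWeighted`

statement-level skeleton of published theorems with citation tags; proofs where landed; nothing here is a claim about the Yang–Mills mass gap

CITATION HEADER (lean-in-tree rule).  Audit cell `pub-balaban`, sub-cell `t4`, BINDER row NE9; TYPED by NE9 formalisation-swarm LEAF PROVER 02 (lineage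
`b2b-balaban-t4-ne9-formalise-leaf-02`, gen 71) as a ZERO-WEIGHT OFFER to the row OWNER `t4-ne9-p1` (whose plan v10 §5 keeps (D-A) for the owner): the
`k`-fold twin of the OWNER's `B9Eq342SupNormBootstrapWeighted.norm_le_of_kato_bootstrap_weighted`, by the SAME two devices (Kato domination
`B9Eq323KatoDomination.norm_le_scalar_of_resolvent` = [DodziukMathai2006] proof of Thm 1.5, and the weighted maximum principle
`B9Eq342SupNormBootstrap.scalar_le_mul_of_supersolution` = [DodziukMathai2006] Lemma 1.1 against a supersolution), iterated along the chain with
`scalar_resolvent_mono` ∕ `scalar_resolvent_add_smul`.  Sources as quoted in those files; NOTHING printed is used as a hypothesis; the `[cite: …]` tags are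
TEXT LOCATIONS only; every statement is `[folklore]` (ABSOLUTE RULE).

WHAT IS PROVED (sorry-free; 0 `def`).  Data of `B9Eq342SupNormBootstrap` + a weight `W`, `0 < λ`, `λ·W ≤ (L₀+m)W` pointwise.
* `exists_scalar_chain` — a `k`-chain from any datum ([DodziukMathai2006] Lemma 1.1 iterated).
* `scalar_chain_dom` — domination propagates along chains: `a₀ ≤ b₀ + m·c₀` ⟹ `a_j ≤ b_j + m·c_j`.
* `scalar_chain_le_weight` — the data chain against the supersolution: `D₀ ≤ s·λ·W` ⟹ `D_l ≤ s·λ·λ^{−l}·W`.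
* **`norm_le_of_kato_bootstrap_weighted_chain`** — `(L u)(x) = f x − q x`, `‖f y‖ + ‖q y‖ ≤ s·λ·W y`, ANY chain `φ₀ = ‖u‖`, `(L₀+m)φ_{j+1} = φ_j` (`j < k`):
  `‖u x‖ ≤ s·W x·Σ_{l<k}(m∕λ)^l + m^k·φ_k x` at every site; **`…_centre`** — at a site with `W x₀ = 1`.
HONEST SCOPE.  Abstract [folklore] bookkeeping on a finite weighted graph; the free value `φ_k(x₀)` is left to (D-FS); VALUE row only; no ∇-row; nothing of
[B9] Thm 3.1 asserted or valued.  NOT summit progress (cell pub-balaban: NE9 NOT PRINTED ∕ NOT PROVED; «NE9 ⇐ the named binders»; row WALLED ON A MODEL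
(O-NE9-1; #5 UNRULED); spine PROVED 0∕9; rung (B)+1 finite T⁴ — NOT infinite volume, NOT mass gap, NOT BetaPertH, NOT Clay).  HONEST DEPENDENCY (cell line):
continuum YM on T⁴ ⇐ BetaPertH ∧ nine spine estimates (0/9 proved); BetaPertH ⇐ (D1) ∧ (D4) ∧ CAP+tail; G-an2-4 gates asym, D1 and NE2/3/4.  NEW file importing
`B9Eq342SupNormBootstrap` only; nothing modified.  Net new unproved facts: 0.
-/

noncomputable section

open scoped InnerProductSpace ComplexConjugate BigOperators

namespace Literature.MathematicalPhysics.QuantumFieldTheory.Balaban1983to89.B9Eq342SupNormBootstrapWeightedChain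

open B9Eq323KatoDomination (norm_le_scalar_of_resolvent exists_scalar_resolvent)
open B9Eq342SupNormBootstrap (scalar_resolvent_mono scalar_resolvent_add_smul scalar_le_mul_of_supersolution)

variable {𝕜 : Type*} [RCLike 𝕜] {V : Type*} [NormedAddCommGroup V] [InnerProductSpace 𝕜 V]
  {ι J : Type*} [Fintype ι] [Fintype J]

/-- **A `k`-CHAIN FROM ANY DATUM**: `φ₀ = g`, `(L₀+m)φ_{j+1} = φ_j` (`j < k`) — [DodziukMathai2006] Lemma 1.1's `(Δ+λI)⁻¹` iterated.
[cite: DodziukMathai2006, Lemma 1.1 §1] -/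
theorem exists_scalar_chain (nbr : ι → J → ι) (w : ι → J → ℝ) (hw : ∀ x j, 0 ≤ w x j) {m : ℝ} (hm : 0 < m) (g : ι → ℝ) (k : ℕ) :
    ∃ φ : ℕ → ι → ℝ, φ 0 = g ∧ ∀ j < k, ∀ x, ∑ i, w x i * (φ (j + 1) x - φ (j + 1) (nbr x i)) + m * φ (j + 1) x = φ j x := by
  induction k with
  | zero => exact ⟨fun _ => g, rfl, fun j hj => absurd hj (Nat.not_lt_zero j)⟩
  | succ k ih =>
      obtain ⟨φ, h0, hφ⟩ := ih
      obtain ⟨χ, hχ⟩ := exists_scalar_resolvent nbr w hw hm (φ k)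
      refine ⟨fun j => if j = k + 1 then χ else φ j, ?_, fun j hj x => ?_⟩
      · show (if 0 = k + 1 then χ else φ 0) = g
        rw [if_neg (by omega), h0]
      · show ∑ i, w x i * ((if j + 1 = k + 1 then χ else φ (j + 1)) x - (if j + 1 = k + 1 then χ else φ (j + 1)) (nbr x i)) +
            m * (if j + 1 = k + 1 then χ else φ (j + 1)) x = (if j = k + 1 then χ else φ j) x
        rcases Nat.lt_or_ge j k with hlt | hge
        · rw [if_neg (show j + 1 ≠ k + 1 by omega), if_neg (show j ≠ k + 1 by omega)]
          exact hφ j hlt x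
        · have heq : j = k := by omega
          rw [if_pos (show j + 1 = k + 1 by omega), if_neg (show j ≠ k + 1 by omega), heq]
          exact hχ x

/-- **DOMINATION PROPAGATES ALONG CHAINS** (monotonicity + linearity of `(L₀+m)⁻¹`): for chains `a, b, c` (`(L₀+m)a_{j+1} = a_j` etc., `j < k`) with
`a₀ ≤ b₀ + m·c₀` pointwise: `a_j ≤ b_j + m·c_j` for all `j ≤ k`. [cite: DodziukMathai2006, Lemma 1.1 §1] -/
theorem scalar_chain_dom (nbr : ι → J → ι) (w : ι → J → ℝ) (hw : ∀ x j, 0 ≤ w x j) {m : ℝ} (hm : 0 < m) {k : ℕ} {a b c : ℕ → ι → ℝ}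
    (ha : ∀ j < k, ∀ x, ∑ i, w x i * (a (j + 1) x - a (j + 1) (nbr x i)) + m * a (j + 1) x = a j x)
    (hb : ∀ j < k, ∀ x, ∑ i, w x i * (b (j + 1) x - b (j + 1) (nbr x i)) + m * b (j + 1) x = b j x)
    (hc : ∀ j < k, ∀ x, ∑ i, w x i * (c (j + 1) x - c (j + 1) (nbr x i)) + m * c (j + 1) x = c j x)
    (h0 : ∀ x, a 0 x ≤ b 0 x + m * c 0 x) : ∀ j ≤ k, ∀ x, a j x ≤ b j x + m * c j x := by
  intro j hj
  induction j with
  | zero => exact h0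
  | succ j ih =>
      intro x
      exact scalar_resolvent_mono nbr w hw hm (ha j hj) (scalar_resolvent_add_smul nbr w m m (hb j hj) (hc j hj))
        (ih (Nat.le_of_succ_le hj)) x

/-- **THE DATA CHAIN AGAINST THE SUPERSOLUTION**: `λW ≤ (L₀+m)W` (`0 < λ`), `D₀ ≤ s·λ·W` (`0 ≤ s`), `(L₀+m)D_{l+1} = D_l` (`l < k`) ⟹ `D_l ≤ s·λ·λ^{−l}·W`
for `l ≤ k` (the weighted maximum principle `scalar_le_mul_of_supersolution`, iterated). [cite: DodziukMathai2006, Lemma 1.1 §1; Balaban1985BackgroundPropagators, Thm 3.1 (3.42) p.397] -/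
theorem scalar_chain_le_weight (nbr : ι → J → ι) (w : ι → J → ℝ) (hw : ∀ x j, 0 ≤ w x j) {m : ℝ} (hm : 0 < m)
    {W : ι → ℝ} {lam : ℝ} (hlam : 0 < lam) (hsup : ∀ x, lam * W x ≤ ∑ i, w x i * (W x - W (nbr x i)) + m * W x)
    {s : ℝ} (hs : 0 ≤ s) {k : ℕ} {D : ℕ → ι → ℝ} (hD0 : ∀ y, D 0 y ≤ s * (lam * W y))
    (hD : ∀ j < k, ∀ x, ∑ i, w x i * (D (j + 1) x - D (j + 1) (nbr x i)) + m * D (j + 1) x = D j x) :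
    ∀ l ≤ k, ∀ y, D l y ≤ s * lam * (lam ^ l)⁻¹ * W y := by
  intro l hl
  induction l with
  | zero => intro y; rw [pow_zero, inv_one, mul_one, mul_assoc]; exact hD0 y
  | succ l ih =>
      intro y
      have hprev := ih (Nat.le_of_succ_le hl)
      have h := scalar_le_mul_of_supersolution nbr w hw hm (s := s * lam * (lam ^ (l + 1))⁻¹) (by positivity) hsup (hD l hl)
        (fun z => ?_) y
      · exact h
      · calc D l z ≤ s * lam * (lam ^ l)⁻¹ * W z := hprev z
          _ = s * lam * (lam ^ (l + 1))⁻¹ * (lam * W z) := by rw [pow_succ]; field_simp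

/-- **THE WEIGHTED BOOTSTRAP WITH `k` DOMINATIONS.**  `(L u)(x) = f x − q x` (covariant, contractive transporters), `0 < m`, a supersolution weight
`λW ≤ (L₀+m)W` (`0 < λ`), data `‖f y‖ + ‖q y‖ ≤ s·λ·W y` (`0 ≤ s`), and ANY chain `φ₀ = ‖u‖`, `(L₀+m)φ_{j+1} = φ_j` (`j < k`).  Then at every site
`‖u x‖ ≤ s·W x·Σ_{l<k}(m∕λ)^l + m^k·φ_k x` — Kato domination once (`‖u‖ ≤ D₁ + mφ₁`), propagated along the chains (`φ_j ≤ D_{j+1} + mφ_{j+1}`) and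
telescoped; the data chain `D` against the weight.  The free value `φ_k(x)` is the (D-FS) letter's. [cite: Balaban1985BackgroundPropagators, Thm 3.1 (3.42) p.397, (3.39) p.397, (3.24) p.394] -/
theorem norm_le_of_kato_bootstrap_weighted_chain (nbr : ι → J → ι) (w : ι → J → ℝ) (hw : ∀ x j, 0 ≤ w x j) (T : ι → J → V →ₗ[𝕜] V)
    (hT : ∀ x j v, ‖T x j v‖ ≤ ‖v‖) {m : ℝ} (hm : 0 < m)
    {W : ι → ℝ} {lam : ℝ} (hlam : 0 < lam) (hsup : ∀ x, lam * W x ≤ ∑ j, w x j * (W x - W (nbr x j)) + m * W x)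
    {u f q : ι → V} (hu : ∀ x, ∑ j, (w x j : 𝕜) • (u x - T x j (u (nbr x j))) = f x - q x)
    {s : ℝ} (hs : 0 ≤ s) (hdata : ∀ y, ‖f y‖ + ‖q y‖ ≤ s * (lam * W y))
    {k : ℕ} {φ : ℕ → ι → ℝ} (hφ0 : ∀ y, φ 0 y = ‖u y‖)
    (hφ : ∀ j < k, ∀ x, ∑ i, w x i * (φ (j + 1) x - φ (j + 1) (nbr x i)) + m * φ (j + 1) x = φ j x) (x : ι) :
    ‖u x‖ ≤ s * W x * ∑ l ∈ Finset.range k, (m / lam) ^ l + m ^ k * φ k x := by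
  -- the resolvent equation `(L + m)u = f − q + m u`
  have hu' : ∀ y, ∑ j, (w y j : 𝕜) • (u y - T y j (u (nbr y j))) + (m : 𝕜) • u y = f y - q y + (m : 𝕜) • u y := fun y => by rw [hu y]
  -- the data chain `D₀ = ‖f‖ + ‖q‖`
  obtain ⟨D, hD0, hD⟩ := exists_scalar_chain nbr w hw hm (fun y => ‖f y‖ + ‖q y‖) k
  -- FIRST DOMINATION `‖u‖ ≤ D₁ + m φ₁` (needs `1 ≤ k`; for `k = 0` the claim is `‖u‖ ≤ φ₀`)
  rcases Nat.eq_zero_or_pos k with hk | hk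
  · subst hk
    rw [Finset.range_zero, Finset.sum_empty, mul_zero, zero_add, pow_zero, one_mul, hφ0]
  have hdom1 : ∀ y, ‖u y‖ ≤ D 1 y + m * φ 1 y := fun y =>
    norm_le_scalar_of_resolvent nbr w hw T hT hm hu' (scalar_resolvent_add_smul nbr w m m (hD 0 hk) (hφ 0 hk)) (fun z => by
      refine (norm_add_le _ _).trans (add_le_add ((norm_sub_le _ _).trans (le_of_eq ?_)) ?_)
      · rw [hD0]
      · rw [norm_smul, RCLike.norm_ofReal, abs_of_pos hm, hφ0]) y
  -- PROPAGATE: `φ_j ≤ D_{j+1} + m φ_{j+1}` for `j ≤ k − 1`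
  have hprop : ∀ j ≤ k - 1, ∀ y, φ j y ≤ D (j + 1) y + m * φ (j + 1) y :=
    scalar_chain_dom nbr w hw hm (a := φ) (b := fun j => D (j + 1)) (c := fun j => φ (j + 1))
      (fun j hj => hφ j (by omega)) (fun j hj => hD (j + 1) (by omega)) (fun j hj => hφ (j + 1) (by omega))
      (fun y => by rw [hφ0]; exact hdom1 y)
  -- TELESCOPE: `‖u‖ ≤ Σ_{l<i} m^l D_{l+1} + m^i φ_i` for `i ≤ k`
  have htel : ∀ i ≤ k, ∀ y, ‖u y‖ ≤ ∑ l ∈ Finset.range i, m ^ l * D (l + 1) y + m ^ i * φ i y := by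
    intro i hi
    induction i with
    | zero => intro y; rw [Finset.range_zero, Finset.sum_empty, zero_add, pow_zero, one_mul, hφ0]
    | succ i ih =>
        intro y
        have h1 := ih (Nat.le_of_succ_le hi) y
        have h2 : m ^ i * φ i y ≤ m ^ i * (D (i + 1) y + m * φ (i + 1) y) :=
          mul_le_mul_of_nonneg_left (hprop i (by omega) y) (pow_nonneg hm.le i)
        rw [Finset.sum_range_succ, pow_succ]
        nlinarith [h1, h2]
  -- the data chain against the weight
  have hDle : ∀ l ≤ k, ∀ y, D l y ≤ s * lam * (lam ^ l)⁻¹ * W y :=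
    scalar_chain_le_weight nbr w hw hm hlam hsup hs (D := D) (fun y => by rw [hD0]; exact hdata y) hD
  -- assemble
  have hsum : ∑ l ∈ Finset.range k, m ^ l * D (l + 1) x ≤ ∑ l ∈ Finset.range k, s * W x * (m / lam) ^ l :=
    Finset.sum_le_sum fun l hl => by
      have hlk : l + 1 ≤ k := Finset.mem_range.1 hl
      calc m ^ l * D (l + 1) x ≤ m ^ l * (s * lam * (lam ^ (l + 1))⁻¹ * W x) :=
            mul_le_mul_of_nonneg_left (hDle (l + 1) hlk x) (pow_nonneg hm.le l)
        _ = s * W x * (m / lam) ^ l := by rw [pow_succ, div_pow]; field_simp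
  calc ‖u x‖ ≤ ∑ l ∈ Finset.range k, m ^ l * D (l + 1) x + m ^ k * φ k x := htel k le_rfl x
    _ ≤ ∑ l ∈ Finset.range k, s * W x * (m / lam) ^ l + m ^ k * φ k x := by linarith [hsum]
    _ = s * W x * ∑ l ∈ Finset.range k, (m / lam) ^ l + m ^ k * φ k x := by rw [Finset.mul_sum]

/-- **NORMALISED AT THE CENTRE**: if moreover `W x₀ = 1`, `‖u x₀‖ ≤ s·Σ_{l<k}(m∕λ)^l + m^k·φ_k x₀`. [cite: Balaban1985BackgroundPropagators, Thm 3.1 (3.42) p.397] -/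
theorem norm_le_of_kato_bootstrap_weighted_chain_centre (nbr : ι → J → ι) (w : ι → J → ℝ) (hw : ∀ x j, 0 ≤ w x j) (T : ι → J → V →ₗ[𝕜] V)
    (hT : ∀ x j v, ‖T x j v‖ ≤ ‖v‖) {m : ℝ} (hm : 0 < m)
    {W : ι → ℝ} {lam : ℝ} (hlam : 0 < lam) (hsup : ∀ x, lam * W x ≤ ∑ j, w x j * (W x - W (nbr x j)) + m * W x)
    {u f q : ι → V} (hu : ∀ x, ∑ j, (w x j : 𝕜) • (u x - T x j (u (nbr x j))) = f x - q x)
    {s : ℝ} (hs : 0 ≤ s) (hdata : ∀ y, ‖f y‖ + ‖q y‖ ≤ s * (lam * W y))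
    {k : ℕ} {φ : ℕ → ι → ℝ} (hφ0 : ∀ y, φ 0 y = ‖u y‖)
    (hφ : ∀ j < k, ∀ x, ∑ i, w x i * (φ (j + 1) x - φ (j + 1) (nbr x i)) + m * φ (j + 1) x = φ j x) {x₀ : ι} (hx₀ : W x₀ = 1) :
    ‖u x₀‖ ≤ s * ∑ l ∈ Finset.range k, (m / lam) ^ l + m ^ k * φ k x₀ := by
  have h := norm_le_of_kato_bootstrap_weighted_chain nbr w hw T hT hm hlam hsup hu hs hdata hφ0 hφ x₀
  rwa [hx₀, mul_one] at h

end Literature.MathematicalPhysics.QuantumFieldTheory.Balaban1983to89.B9Eq342SupNormBootstrapWeightedChain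

end
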